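import Literature.NumberTheory.Irrationality.Zudilin2014.SecondTaleDeriv
import Literature.NumberTheory.Irrationality.Zudilin2014.FirstTaleLemma7
import Summits.KontsevichZagierPeriods.Zeta5Search.TwoTaleP15SecondTale
import Summits.KontsevichZagierPeriods.Zeta5Search.TwoTaleP15FirstTale

/-!
# The two-tale point P15: Lemma 8 for `B_k` and `p̂` at the partner — part 1 (digit count, `p`-adic bricks, zones)

HONEST FRAMING: systematic search; no irrationality claim unless certified.

Cell pub-zeta5, T3 service.  Zudilin 2014, Lemma 8 / eq. (T3a) [Zudilin2014ZetaTwo, Section 6]: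
`1 + ord_p B_k ≥ E(k)` and `ord_p A_k ≥ E(k)` with the digit count
`E(k) = (⌊(2k−b̂₀)/p⌋−⌊(2k−â₀)/p⌋−⌊(â₀−b̂₀)/p⌋) + (⌊(k−b̂₁)/p⌋−⌊(k−â₁)/p⌋−⌊(â₁−b̂₁)/p⌋)
 + Σ_{j=2,3} (⌊(b̂_j−â_j−1)/p⌋−⌊(k−â_j)/p⌋−⌊(b̂_j−1−k)/p⌋)` (integer floors).  At the partner of P15
(`â = (32n+2; 11n+1, 13n+1, 15n+1)`, `b̂ = (15n+2; 6n+1, 24n+2, 26n+2)`) this file provides `EZ p n k` (= `E(k)`),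
`EZ_rule` (its expression in the residues `r = n mod p`, `s = (k−1) mod p`), `EZ_eq_digitAT`, the `p`-adic bricks
(`padicNorm_inv_int_le`, `padicNorm_choose_le`, alternating harmonic sums), `neg_succ_ediv`, and the zone data:
pole multiplicities `multT_partner`, `eval_numT_partner(_eq_zero)`, **zone α** `coefBT_zoneA` (`B_k = 0` on
`[13n+1, 15n]`), `coefAT_zoneB1` (`A_k = 0` on `[15n+1, 16n]`), `padicNorm_normT_partner`.
Parts 2–3: `TwoTaleP15SecondTaleBZones` (zones β₁, γ), `TwoTaleP15SecondTaleBAssembly` (zone β₂, Lemma 8 for `p̂`,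
bridge to `pP15num`).
-/

noncomputable section

namespace Summit.KontsevichZagierPeriods.Zeta5Search.TwoTaleP15

open Finset Polynomial
open Literature.NumberTheory.Irrationality.Zudilin2014
open Literature.NumberTheory.DiophantineApproximation (RhinViola.padicValNat_factorial_of_lt_sq)
open Literature.NumberTheory.Transcendental (OddZeta.dvd_lcmUpto)
/-! ### The digit count `E(k)` at the partner -/

/-- Zudilin's count `E(k)` (eq. (T3a), Lemma 8's `φ̂ = min_y`) at the partner of P15, with integer floor divisions. -/
def EZ (p n : ℕ) (k : ℤ) : ℤ :=
  ((2 * k - (15 * n + 2)) / (p : ℤ) - (2 * k - (32 * n + 2)) / (p : ℤ) - (17 * n : ℤ) / (p : ℤ))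
  + ((k - (6 * n + 1)) / (p : ℤ) - (k - (11 * n + 1)) / (p : ℤ) - (5 * n : ℤ) / (p : ℤ))
  + ((11 * n : ℤ) / (p : ℤ) - (k - (13 * n + 1)) / (p : ℤ) - (24 * n + 1 - k) / (p : ℤ))
  + ((11 * n : ℤ) / (p : ℤ) - (k - (15 * n + 1)) / (p : ℤ) - (26 * n + 1 - k) / (p : ℤ))

/-- One integer quotient from a decomposition `X = p·A + B`, `⌊B/p⌋ = j`: `X/p = A + j`. -/
theorem ediv_eq_of_decomp {X : ℤ} {p : ℕ} (hp : 0 < p) (A B j : ℤ) (hX : X = p * A + B)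
    (hB : j * p ≤ B ∧ B < (j + 1) * p) : X / (p : ℤ) = A + j := by
  have hp' : (0 : ℤ) < p := by exact_mod_cast hp
  rw [hX, Int.mul_add_ediv_left _ _ hp'.ne', ediv_eq_of_bounds hp' hB]

/-- **`E(k)` in residues** (`r = n mod p`, `s = (k−1) mod p`, digits as in `digit_rule`; valid for every `k`):
`E(k) = (j₀−j₁−j₂) + (j₃−j₄−j₅) + (j₆−j₇−j₈) + (j₆−j₁₀−j₁₁)`. -/
theorem EZ_rule {n p : ℕ} (hp : 0 < p) (k : ℤ)
    (r s : ℤ) (hr : r = (n : ℤ) % p) (hs : s = (k - 1) % p) (j0 j1 j2 j3 j4 j5 j6 j7 j8 j10 j11 : ℤ)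
    (h0 : j0 * p ≤ 2 * s - 15 * r ∧ 2 * s - 15 * r < (j0 + 1) * p)
    (h1 : j1 * p ≤ 2 * s - 32 * r ∧ 2 * s - 32 * r < (j1 + 1) * p)
    (h2 : j2 * p ≤ 17 * r ∧ 17 * r < (j2 + 1) * p)
    (h3 : j3 * p ≤ s - 6 * r ∧ s - 6 * r < (j3 + 1) * p)
    (h4 : j4 * p ≤ s - 11 * r ∧ s - 11 * r < (j4 + 1) * p)
    (h5 : j5 * p ≤ 5 * r ∧ 5 * r < (j5 + 1) * p)
    (h6 : j6 * p ≤ 11 * r ∧ 11 * r < (j6 + 1) * p)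
    (h7 : j7 * p ≤ s - 13 * r ∧ s - 13 * r < (j7 + 1) * p)
    (h8 : j8 * p ≤ 24 * r - s ∧ 24 * r - s < (j8 + 1) * p)
    (h10 : j10 * p ≤ s - 15 * r ∧ s - 15 * r < (j10 + 1) * p)
    (h11 : j11 * p ≤ 26 * r - s ∧ 26 * r - s < (j11 + 1) * p) :
    EZ p n k = (j0 - j1 - j2) + (j3 - j4 - j5) + (j6 - j7 - j8) + (j6 - j10 - j11) := by
  have hp' : (0 : ℤ) < p := by exact_mod_cast hp
  set N : ℤ := (n : ℤ) / p with hN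
  set K : ℤ := (k - 1) / p with hK
  have hn : (n : ℤ) = p * N + r := by rw [hr, hN]; exact (Int.mul_ediv_add_emod _ _).symm
  have hk1 : k - 1 = p * K + s := by rw [hs, hK]; exact (Int.mul_ediv_add_emod _ _).symm
  unfold EZ
  rw [ediv_eq_of_decomp hp (2 * K - 15 * N) (2 * s - 15 * r) j0 (by linear_combination 2 * hk1 - 15 * hn) h0,
    ediv_eq_of_decomp hp (2 * K - 32 * N) (2 * s - 32 * r) j1 (by linear_combination 2 * hk1 - 32 * hn) h1,
    ediv_eq_of_decomp hp (17 * N) (17 * r) j2 (by linear_combination 17 * hn) h2,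
    ediv_eq_of_decomp hp (K - 6 * N) (s - 6 * r) j3 (by linear_combination hk1 - 6 * hn) h3,
    ediv_eq_of_decomp hp (K - 11 * N) (s - 11 * r) j4 (by linear_combination hk1 - 11 * hn) h4,
    ediv_eq_of_decomp hp (5 * N) (5 * r) j5 (by linear_combination 5 * hn) h5,
    ediv_eq_of_decomp hp (11 * N) (11 * r) j6 (by linear_combination 11 * hn) h6,
    ediv_eq_of_decomp hp (K - 13 * N) (s - 13 * r) j7 (by linear_combination hk1 - 13 * hn) h7,
    ediv_eq_of_decomp hp (24 * N - K) (24 * r - s) j8 (by linear_combination 24 * hn - hk1) h8,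
    ediv_eq_of_decomp hp (K - 15 * N) (s - 15 * r) j10 (by linear_combination hk1 - 15 * hn) h10,
    ediv_eq_of_decomp hp (26 * N - K) (26 * r - s) j11 (by linear_combination 26 * hn - hk1) h11]
  ring

/-- On the `q̂`-range with `2k ≥ â₀` (`16n+1 ≤ k ≤ 24n+1`) all twelve arguments are nonnegative and `E(k)` is
the natural-number count `digitAT` of `SecondTale`. -/
theorem EZ_eq_digitAT {n p : ℕ} {k : ℤ} (hk : 16 * (n : ℤ) + 1 ≤ k) (hk' : k ≤ 24 * (n : ℤ) + 1) :
    EZ p n k = (digitAT p (aT n) (bT n) k : ℤ) := by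
  have cast : ∀ X : ℤ, 0 ≤ X → ((X.toNat / p : ℕ) : ℤ) = X / (p : ℤ) := fun X hX => by
    rw [Int.natCast_ediv, Int.toNat_of_nonneg hX]
  have sub0 : (aT n 0 - bT n 0).toNat / p + (2 * k - aT n 0).toNat / p ≤ (2 * k - bT n 0).toNat / p := by
    have e : (2 * k - bT n 0).toNat = (aT n 0 - bT n 0).toNat + (2 * k - aT n 0).toNat := by simp; omega
    rw [e]; exact Nat.add_div_le_add_div _ _ _
  have sub1 : (aT n 1 - bT n 1).toNat / p + (k - aT n 1).toNat / p ≤ (k - bT n 1).toNat / p := by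
    have e : (k - bT n 1).toNat = (aT n 1 - bT n 1).toNat + (k - aT n 1).toNat := by simp; omega
    rw [e]; exact Nat.add_div_le_add_div _ _ _
  have sub2 : (k - aT n 2).toNat / p + (bT n 2 - 1 - k).toNat / p ≤ (bT n 2 - aT n 2 - 1).toNat / p := by
    have e : (bT n 2 - aT n 2 - 1).toNat = (k - aT n 2).toNat + (bT n 2 - 1 - k).toNat := by simp; omega
    rw [e]; exact Nat.add_div_le_add_div _ _ _
  have sub3 : (k - aT n 3).toNat / p + (bT n 3 - 1 - k).toNat / p ≤ (bT n 3 - aT n 3 - 1).toNat / p := by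
    have e : (bT n 3 - aT n 3 - 1).toNat = (k - aT n 3).toNat + (bT n 3 - 1 - k).toNat := by simp; omega
    rw [e]; exact Nat.add_div_le_add_div _ _ _
  have c0 : (((2 * k - bT n 0).toNat / p - (aT n 0 - bT n 0).toNat / p - (2 * k - aT n 0).toNat / p : ℕ) : ℤ)
      = ((2 * k - bT n 0).toNat / p : ℕ) - ((aT n 0 - bT n 0).toNat / p : ℕ) - ((2 * k - aT n 0).toNat / p : ℕ) := by
    omega
  have c1 : (((k - bT n 1).toNat / p - (aT n 1 - bT n 1).toNat / p - (k - aT n 1).toNat / p : ℕ) : ℤ)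
      = ((k - bT n 1).toNat / p : ℕ) - ((aT n 1 - bT n 1).toNat / p : ℕ) - ((k - aT n 1).toNat / p : ℕ) := by
    omega
  have c2 : (((bT n 2 - aT n 2 - 1).toNat / p - (k - aT n 2).toNat / p - (bT n 2 - 1 - k).toNat / p : ℕ) : ℤ)
      = ((bT n 2 - aT n 2 - 1).toNat / p : ℕ) - ((k - aT n 2).toNat / p : ℕ) - ((bT n 2 - 1 - k).toNat / p : ℕ) := by
    omega
  have c3 : (((bT n 3 - aT n 3 - 1).toNat / p - (k - aT n 3).toNat / p - (bT n 3 - 1 - k).toNat / p : ℕ) : ℤ)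
      = ((bT n 3 - aT n 3 - 1).toNat / p : ℕ) - ((k - aT n 3).toNat / p : ℕ) - ((bT n 3 - 1 - k).toNat / p : ℕ) := by
    omega
  unfold digitAT
  rw [Nat.cast_add, Nat.cast_add, Nat.cast_add, c0, c1, c2, c3]
  rw [cast _ (by simp; omega), cast _ (by simp; omega), cast _ (by simp; omega), cast _ (by simp; omega),
    cast _ (by simp; omega), cast _ (by simp; omega), cast _ (by simp; omega), cast _ (by simp; omega),
    cast _ (by simp; omega), cast _ (by simp; omega), cast _ (by simp; omega), cast _ (by simp; omega)]
  unfold EZ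
  simp only [aT_zero, aT_one, aT_two, aT_three, bT_zero, bT_one, bT_two, bT_three]
  have e1 : (32 * (n : ℤ) + 2 - (15 * n + 2)) = 17 * n := by ring
  have e2 : (11 * (n : ℤ) + 1 - (6 * n + 1)) = 5 * n := by ring
  have e3 : (24 * (n : ℤ) + 2 - (13 * n + 1) - 1) = 11 * n := by ring
  have e4 : (26 * (n : ℤ) + 2 - (15 * n + 1) - 1) = 11 * n := by ring
  have e5 : (24 * (n : ℤ) + 2 - 1 - k) = 24 * n + 1 - k := by ring
  have e6 : (26 * (n : ℤ) + 2 - 1 - k) = 26 * n + 1 - k := by ring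
  rw [e1, e2, e3, e4, e5, e6]
  ring

/-! ### `p`-adic bookkeeping -/

section Padic

variable {p : ℕ} [hp : Fact p.Prime]

/-- `‖1/d‖_p ≤ p` for a nonzero integer `d` with `|d| < p²`. -/
theorem padicNorm_inv_int_le {d : ℤ} (hd : d ≠ 0) (hlt : d.natAbs < p ^ 2) :
    padicNorm p (1 / (d : ℚ)) ≤ p := by
  have hp1 : 1 < p := hp.out.one_lt
  have hv : padicValInt p d ≤ 1 := by
    by_contra h
    push Not at h
    have hdvd : (p : ℤ) ^ 2 ∣ d := (padicValInt_dvd_iff 2 d).2 (Or.inr (by omega))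
    have : p ^ 2 ≤ d.natAbs := Nat.le_of_dvd (Int.natAbs_pos.2 hd) (by
      have := Int.natAbs_dvd_natAbs.2 hdvd; simpa using this)
    omega
  have hd' : (d : ℚ) ≠ 0 := by exact_mod_cast hd
  rw [one_div, padicNorm.eq_zpow_of_nonzero (inv_ne_zero hd'), padicValRat.inv, padicValRat.of_int, neg_neg]
  calc (p : ℚ) ^ (padicValInt p d : ℤ) ≤ (p : ℚ) ^ (1 : ℤ) :=
        zpow_le_zpow_right₀ (by exact_mod_cast hp1.le) (by exact_mod_cast hv)
    _ = p := zpow_one _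

/-- Kummer's first carry as a norm bound: `‖binom(M,m)‖_p ≤ p^{−(⌊M/p⌋−⌊m/p⌋−⌊(M−m)/p⌋)}`. -/
theorem padicNorm_choose_le {M m : ℕ} (h : m ≤ M) :
    padicNorm p ((Nat.choose M m : ℕ) : ℚ) ≤ (p : ℚ) ^ (-((M / p - m / p - (M - m) / p : ℕ) : ℤ)) := by
  have hd := pow_firstDigit_dvd_choose (p := p) h
  have hd' : ((p ^ (M / p - m / p - (M - m) / p) : ℕ) : ℤ) ∣ ((M.choose m : ℕ) : ℤ) := by exact_mod_cast hd
  have := (padicNorm.dvd_iff_norm_le (p := p)).1 hd'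
  simpa using this

/-- One Legendre digit for a factorial, as `padicValRat`. -/
theorem padicValRat_factorial_of_lt_sq {m : ℕ} (hm : m < p ^ 2) :
    padicValRat p ((m.factorial : ℕ) : ℚ) = ((m / p : ℕ) : ℤ) := by
  rw [padicValRat.of_nat, RhinViola.padicValNat_factorial_of_lt_sq hm]

/-- `‖(−1)^ℓ‖_p ≤ 1` and `‖1/(ℓ+1)‖_p ≤ p` for `ℓ + 1 < p²`: the bricks of the alternating harmonic sums. -/
theorem padicNorm_altTerm_le {l : ℕ} (hl : l + 1 < p ^ 2) :
    padicNorm p ((-1 : ℚ) ^ l) ≤ 1 ∧ padicNorm p (1 / ((l : ℚ) + 1)) ≤ p := by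
  constructor
  · have := padicNorm.of_int (p := p) ((-1) ^ l); push_cast at this; exact this
  · have hne : ((l : ℤ) + 1) ≠ 0 := by omega
    have h1 := padicNorm_inv_int_le (p := p) hne (by omega)
    push_cast at h1; exact h1

/-- `‖Σ_{ℓ≤m} (−1)^{ℓ−1}/ℓ²‖_p ≤ p²` for `m < p²`. -/
theorem padicNorm_harmAlt2_le {m : ℕ} (hm : m < p ^ 2) : padicNorm p (harmAlt2 m) ≤ (p : ℚ) ^ (2 : ℤ) := by
  unfold harmAlt2
  refine padicNorm.sum_le' (fun l hl => ?_) (by positivity)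
  obtain ⟨hs, h1⟩ := padicNorm_altTerm_le (p := p) (l := l) (by have := mem_range.1 hl; omega)
  have e : (-1 : ℚ) ^ l / ((l : ℚ) + 1) ^ 2 = (-1) ^ l * (1 / ((l : ℚ) + 1)) * (1 / ((l : ℚ) + 1)) := by
    field_simp
  rw [e, padicNorm.mul, padicNorm.mul]
  have hp0 : (0 : ℚ) ≤ p := by positivity
  calc padicNorm p ((-1 : ℚ) ^ l) * padicNorm p (1 / ((l : ℚ) + 1)) * padicNorm p (1 / ((l : ℚ) + 1))
      ≤ 1 * p * p := mul_le_mul (mul_le_mul hs h1 (padicNorm.nonneg _) zero_le_one) h1 (padicNorm.nonneg _)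
          (by positivity)
    _ = (p : ℚ) ^ (2 : ℤ) := by rw [one_mul, zpow_two]

/-- `‖Σ_{ℓ≤m} (−1)^{ℓ−1}/ℓ‖_p ≤ p` for `m < p²`. -/
theorem padicNorm_harmAlt1_le {m : ℕ} (hm : m < p ^ 2) : padicNorm p (harmAlt1 m) ≤ (p : ℚ) ^ (1 : ℤ) := by
  unfold harmAlt1
  refine padicNorm.sum_le' (fun l hl => ?_) (by positivity)
  obtain ⟨hs, h1⟩ := padicNorm_altTerm_le (p := p) (l := l) (by have := mem_range.1 hl; omega)
  have e : (-1 : ℚ) ^ l / ((l : ℚ) + 1) = (-1) ^ l * (1 / ((l : ℚ) + 1)) := by ring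
  rw [e, padicNorm.mul, zpow_one]
  calc padicNorm p ((-1 : ℚ) ^ l) * padicNorm p (1 / ((l : ℚ) + 1)) ≤ 1 * (p : ℚ) :=
        mul_le_mul hs h1 (padicNorm.nonneg _) zero_le_one
    _ = p := one_mul _

end Padic

/-- `⌊−(u+1)/p⌋ = −⌊u/p⌋ − 1` (integer floor division by `p > 0`). -/
theorem neg_succ_ediv {p : ℕ} (u : ℤ) (hp0 : 0 < p) : (-(u + 1)) / (p : ℤ) = -(u / (p : ℤ)) - 1 := by
  have hp' : (0 : ℤ) < p := by exact_mod_cast hp0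
  have h1 := Int.ediv_mul_le u hp'.ne'
  have h2 := Int.lt_mul_ediv_self_add (x := u) hp'
  apply ediv_eq_of_bounds hp'
  constructor <;> nlinarith


/-! ### The zones of `B_k` at the partner -/

section Zones

variable {n : ℕ} {p : ℕ} [hp : Fact p.Prime]

/-- Pole multiplicities at the partner: `mult k = 1` on `[13n+1, 15n]`, `2` on `[15n+1, 24n+1]`, `1` on
`[24n+2, 26n+1]`. -/
theorem multT_partner (k : ℤ) :
    (13 * (n : ℤ) + 1 ≤ k → k ≤ 15 * (n : ℤ) → multT (aT n) (bT n) k = 1) ∧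
    (15 * (n : ℤ) + 1 ≤ k → k ≤ 24 * (n : ℤ) + 1 → multT (aT n) (bT n) k = 2) ∧
    (24 * (n : ℤ) + 2 ≤ k → k ≤ 26 * (n : ℤ) + 1 → multT (aT n) (bT n) k = 1) := by
  unfold multT
  simp only [mem_Ico, aT_two, aT_three, bT_two, bT_three]
  refine ⟨fun h1 h2 => ?_, fun h1 h2 => ?_, fun h1 h2 => ?_⟩
  · rw [if_pos (by omega), if_neg (by omega)]
  · rw [if_pos (by omega), if_pos (by omega)]
  · rw [if_neg (by omega), if_pos (by omega)]

/-- `numT(−k) = Π̂ · ∏_{ℓ∈[15n+2,32n+2)} (ℓ − 2k) · ∏_{i∈[6n+1,11n+1)} (i − k)`. -/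
theorem eval_numT_partner (k : ℤ) :
    (numT (aT n) (bT n)).eval (-(k : ℚ)) = normT (aT n) (bT n)
      * (∏ l ∈ Ico (bT n 0) (aT n 0), ((l : ℚ) - ((2 * k : ℤ) : ℚ)))
      * ∏ i ∈ Ico (bT n 1) (aT n 1), ((i : ℚ) - k) := by
  unfold numT
  rw [eval_mul, eval_C, eval_mul, eval_block2, eval_block, mul_assoc]
  congr 1; congr 1
  · exact prod_congr rfl fun l _ => by push_cast; ring
  · exact prod_congr rfl fun i _ => by ring

/-- The doubled block vanishes at `−k` when `15n+2 ≤ 2k < 32n+2`. -/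
theorem eval_numT_partner_eq_zero {k : ℤ} (h1 : 15 * (n : ℤ) + 2 ≤ 2 * k) (h2 : 2 * k < 32 * (n : ℤ) + 2) :
    (numT (aT n) (bT n)).eval (-(k : ℚ)) = 0 := by
  rw [eval_numT_partner]
  have hmem : 2 * k ∈ Ico (bT n 0) (aT n 0) := by simp [mem_Ico]; omega
  rw [prod_eq_zero hmem (by simp), mul_zero, zero_mul]

/-- **Zone α** (`13n+1 ≤ k ≤ 15n`): `B_k = 0` (simple pole of the denominator cancelled by a numerator zero). -/
theorem coefBT_zoneA {k : ℤ} (h1 : 13 * (n : ℤ) + 1 ≤ k) (h2 : k ≤ 15 * (n : ℤ)) :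
    coefBT (aT n) (bT n) k = 0 := by
  rw [coefBT_of_simple ((multT_partner k).1 h1 h2), eval_numT_partner_eq_zero (by omega) (by omega),
    zero_div]

/-- **`A_k = 0` on `[15n+1, 16n]`** (numerator zero). -/
theorem coefAT_zoneB1 {k : ℤ} (h1 : 15 * (n : ℤ) + 1 ≤ k) (h2 : k ≤ 16 * (n : ℤ)) :
    coefAT (aT n) (bT n) k = 0 := by
  unfold coefAT
  rw [qpolyT_eq_of_double (by simp [mem_Ico]; omega) (by simp [mem_Ico]; omega),
    eval_numT_partner_eq_zero (by omega) (by omega), zero_div]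

/-- One-digit Legendre for `facZ`-style factorial casts of naturals: `‖m!‖_p = p^{−⌊m/p⌋}` (`m < p²`). -/
theorem padicNorm_factorial {m : ℕ} (hm : m < p ^ 2) :
    padicNorm p ((m.factorial : ℕ) : ℚ) = (p : ℚ) ^ (-((m / p : ℕ) : ℤ)) := by
  rw [padicNorm.eq_zpow_of_nonzero (by positivity), padicValRat_factorial_of_lt_sq hm]

/-- Norm of `Π̂` at the partner: `‖Π̂‖_p = p^{−(2⌊11n/p⌋ − ⌊17n/p⌋ − ⌊5n/p⌋)}` (`26n < p²`). -/
theorem padicNorm_normT_partner (hp2 : 26 * n < p ^ 2) :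
    padicNorm p (normT (aT n) (bT n))
      = (p : ℚ) ^ (-(((11 * n / p : ℕ) : ℤ) + ((11 * n / p : ℕ) : ℤ) - ((17 * n / p : ℕ) : ℤ)
          - ((5 * n / p : ℕ) : ℤ))) := by
  have e2 : (bT n 2 - aT n 2 - 1).toNat = 11 * n := by simp; omega
  have e3 : (bT n 3 - aT n 3 - 1).toNat = 11 * n := by simp; omega
  have e0 : (aT n 0 - bT n 0).toNat = 17 * n := by simp; omega
  have e1 : (aT n 1 - bT n 1).toNat = 5 * n := by simp; omega
  have f11 : padicNorm p (((11 * n).factorial : ℕ) : ℚ) = (p : ℚ) ^ (-((11 * n / p : ℕ) : ℤ)) :=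
    padicNorm_factorial (by omega)
  have f17 : padicNorm p (((17 * n).factorial : ℕ) : ℚ) = (p : ℚ) ^ (-((17 * n / p : ℕ) : ℤ)) :=
    padicNorm_factorial (by omega)
  have f5 : padicNorm p (((5 * n).factorial : ℕ) : ℚ) = (p : ℚ) ^ (-((5 * n / p : ℕ) : ℤ)) :=
    padicNorm_factorial (by omega)
  unfold normT facZ
  rw [e2, e3, e0, e1, padicNorm.div, padicNorm.mul, padicNorm.mul, f11, f17, f5]
  have hp0 : (p : ℚ) ≠ 0 := by exact_mod_cast hp.out.ne_zero
  rw [← zpow_add₀ hp0, ← zpow_add₀ hp0, ← zpow_sub₀ hp0]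
  congr 1; ring

end Zones
end Summit.KontsevichZagierPeriods.Zeta5Search.TwoTaleP15

end
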